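import Mathlib

/-!
# PercRepro — THE SQUARE-SUM VALUE OF THE NESTED CONFIGURATION AND ITS ARITHMETIC (p3, gen 55; part 298)

For `s = m D + r` (`r < D`) the NESTED bipartite configuration — `m` columns of height `D`, one column of height
`r`, the conjugate rows (`r` of length `m + 1`, `D − r` of length `m`) — has square sum

  **`sqNest m r D = m D (D + m) + r (r + 2 m + 1)`**,   `sqMax s D = sqNest (s / D) (s % D) D`.

Part 299 proves `Σ_v d(v)² ≤ sqMax s D` for every triangle-free graph with `s ≤ D²` edges and every degree `≤ D`
by deleting a vertex of degree `D` (when there is one) or descending to `D − 1`; the arithmetic it needs is here: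
THE STEP `sqMax s D + D = sqMax (s − D) D + D² + 2 s` (`sqMax_step`, `D ≤ s`), THE MONOTONICITY
`sqMax s d ≤ sqMax s (d + 1)` for `s ≤ d²` (`sqMax_mono`: the nested value grows with the degree bound) and
THE REGULAR COMPARISON `2 s d ≤ sqMax s (d + 1)` for `d² < s ≤ (d + 1)²` (`sqMax_ge_regular`).  Axioms: standard.
-/

namespace PercRepro

namespace TriangleCap

namespace C047

/-- The square sum of the nested configuration with `m` full columns of height `D`, one column of height `r` and the
conjugate rows: `m D (D + m) + r (r + 2 m + 1)`. -/
def sqNest (m r D : ℕ) : ℕ := m * D * (D + m) + r * (r + 2 * m + 1)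

/-- The nested square-sum value of `s` edges with degree bound `D`: `sqNest (s / D) (s % D) D`. -/
def sqMax (s D : ℕ) : ℕ := sqNest (s / D) (s % D) D

/-- `sqMax s D = sqNest m r D` when `s = m D + r` with `r < D`. -/
theorem sqMax_eq (s D m r : ℕ) (hD : 0 < D) (hs : s = m * D + r) (hr : r < D) : sqMax s D = sqNest m r D := by
  have h := (Nat.div_mod_unique hD (a := s) (d := m) (c := r)).mpr ⟨by rw [hs]; ring, hr⟩
  unfold sqMax
  rw [h.1, h.2]

/-- `sqMax 0 D = 0`. -/
theorem sqMax_zero (D : ℕ) : sqMax 0 D = 0 := by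
  unfold sqMax sqNest
  simp

/-- `sqNest 0 0 D = 0`. -/
theorem sqNest_zero (D : ℕ) : sqNest 0 0 D = 0 := by
  unfold sqNest
  ring

/-- **THE STEP:** `sqNest (m + 1) r D + D = sqNest m r D + D² + 2 ((m + 1) D + r)`. -/
theorem sqNest_step (m r D : ℕ) : sqNest (m + 1) r D + D = sqNest m r D + D * D + 2 * ((m + 1) * D + r) := by
  unfold sqNest
  ring

/-- **THE STEP OF `sqMax`:** `sqMax s D + D = sqMax (s − D) D + D² + 2 s` for `D ≤ s`, `0 < D`. -/
theorem sqMax_step (s D : ℕ) (hD : 0 < D) (hs : D ≤ s) : sqMax s D + D = sqMax (s - D) D + D * D + 2 * s := by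
  obtain ⟨m, r, hr, hsm⟩ : ∃ m r, r < D ∧ s = m * D + r :=
    ⟨s / D, s % D, Nat.mod_lt s hD, by have := Nat.div_add_mod s D; rw [mul_comm] at this; omega⟩
  rcases m with _ | m
  · omega
  · rw [sqMax_eq s D (m + 1) r hD hsm hr, sqMax_eq (s - D) D m r hD (by rw [hsm]; ring_nf; omega) hr, hsm]
    exact sqNest_step m r D

/-- The first monotonicity identity: `sqNest m r (d + 1) = sqNest m (m + r) d + 2 m (d − m − r)` for
`d = m + r + 1 + e`. -/
theorem sqNest_mono_low (m r e : ℕ) :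
    sqNest m r (m + r + 1 + e + 1) = sqNest m (m + r) (m + r + 1 + e) + 2 * m * (e + 1) := by
  unfold sqNest
  ring

/-- The second monotonicity identity: `sqNest m r (d + 1) = sqNest (m + 1) ρ d + 2 ρ e` for `d = m + 1 + e`,
`r = ρ + 1 + e`. -/
theorem sqNest_mono_high (m ρ e : ℕ) :
    sqNest m (ρ + 1 + e) (m + 1 + e + 1) = sqNest (m + 1) ρ (m + 1 + e) + 2 * ρ * e := by
  unfold sqNest
  ring

/-- **THE MONOTONICITY:** `sqMax s d ≤ sqMax s (d + 1)` for `s ≤ d²` — the nested square sum grows with the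
degree bound. -/
theorem sqMax_mono (s d : ℕ) (hs : s ≤ d * d) : sqMax s d ≤ sqMax s (d + 1) := by
  rcases Nat.eq_zero_or_pos d with rfl | hd
  · have : s = 0 := by omega
    subst this
    rw [sqMax_zero, sqMax_zero]
  · -- `s = m (d + 1) + r` with `r ≤ d`
    obtain ⟨m, r, hr, hsm⟩ : ∃ m r, r < d + 1 ∧ s = m * (d + 1) + r :=
      ⟨s / (d + 1), s % (d + 1), Nat.mod_lt s (by omega), by
        have := Nat.div_add_mod s (d + 1); rw [mul_comm] at this; omega⟩
    rw [sqMax_eq s (d + 1) m r (by omega) hsm hr]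
    -- `m ≤ d − 1`: `m (d + 1) ≤ s ≤ d²`
    have hm : m + 1 ≤ d := by
      by_contra h
      have h1 : d ≤ m := by omega
      have : d * (d + 1) ≤ m * (d + 1) := Nat.mul_le_mul_right _ h1
      nlinarith
    rcases Nat.lt_or_ge (m + r) d with hlow | hhigh
    · -- `s / d = m`, `s % d = m + r`
      have hsd : sqMax s d = sqNest m (m + r) d :=
        sqMax_eq s d m (m + r) hd (by rw [hsm]; ring) hlow
      rw [hsd]
      obtain ⟨e, rfl⟩ : ∃ e, d = m + r + 1 + e := ⟨d - (m + r + 1), by omega⟩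
      rw [sqNest_mono_low]
      omega
    · -- `s / d = m + 1`, `s % d = m + r − d`
      have hsd : sqMax s d = sqNest (m + 1) (m + r - d) d :=
        sqMax_eq s d (m + 1) (m + r - d) hd (by rw [hsm]; ring_nf; omega) (by omega)
      rw [hsd]
      obtain ⟨e, he⟩ : ∃ e, d = m + 1 + e := ⟨d - (m + 1), by omega⟩
      obtain ⟨ρ, hρ⟩ : ∃ ρ, r = ρ + 1 + e := ⟨r - (1 + e), by omega⟩
      have hmr : m + r - d = ρ := by omega
      rw [hmr, hρ, he, sqNest_mono_high]
      omega

/-- The regular comparison at `m = d − 1`: `sqNest m r (m + 2) = 2 (m (m + 2) + r) (m + 1) + r (r − 1)`. -/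
theorem sqNest_reg_low (m r : ℕ) (hr : 1 ≤ r) :
    sqNest m r (m + 2) = 2 * ((m * (m + 2) + r) * (m + 1)) + r * (r - 1) := by
  obtain ⟨r', rfl⟩ : ∃ r', r = r' + 1 := ⟨r - 1, by omega⟩
  unfold sqNest
  rw [Nat.add_sub_cancel]
  ring

/-- The regular comparison at `m = d`: `sqNest d r (d + 1) = 2 (d (d + 1) + r) d + d (d + 1) + r (r + 1)`. -/
theorem sqNest_reg_mid (d r : ℕ) :
    sqNest d r (d + 1) = 2 * ((d * (d + 1) + r) * d) + d * (d + 1) + r * (r + 1) := by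
  unfold sqNest
  ring

/-- **THE REGULAR COMPARISON:** `2 s d ≤ sqMax s (d + 1)` for `d² < s ≤ (d + 1)²` — the value of every graph with
degrees `≤ d` (at most `2 s d`) is below the nested value for the bound `d + 1`. -/
theorem sqMax_ge_regular (s d : ℕ) (h1 : d * d < s) (h2 : s ≤ (d + 1) * (d + 1)) : 2 * (s * d) ≤ sqMax s (d + 1) := by
  obtain ⟨m, r, hr, hsm⟩ : ∃ m r, r < d + 1 ∧ s = m * (d + 1) + r :=
    ⟨s / (d + 1), s % (d + 1), Nat.mod_lt s (by omega), by
      have := Nat.div_add_mod s (d + 1); rw [mul_comm] at this; omega⟩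
  rw [sqMax_eq s (d + 1) m r (by omega) hsm hr]
  -- `m ∈ {d − 1, d, d + 1}`
  have hm1 : d ≤ m + 1 := by
    by_contra h
    have h1' : m + 2 ≤ d := by omega
    have : (m + 2) * (d + 1) ≤ d * (d + 1) := Nat.mul_le_mul_right _ h1'
    nlinarith
  have hm2 : m ≤ d + 1 := by
    by_contra h
    have h1' : d + 2 ≤ m := by omega
    have : (d + 2) * (d + 1) ≤ m * (d + 1) := Nat.mul_le_mul_right _ h1'
    nlinarith
  rcases Nat.lt_or_ge m d with hlt | hge
  · -- `m = d − 1`, `r ≥ 2`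
    obtain ⟨m', rfl⟩ : ∃ m', d = m' + 1 := ⟨d - 1, by omega⟩
    have hmm : m = m' := by omega
    subst hmm
    have hr2 : 1 ≤ r := by nlinarith
    rw [hsm, sqNest_reg_low m r hr2]
    nlinarith
  · rcases Nat.lt_or_ge m (d + 1) with hmid | hhigh
    · have hmm : m = d := by omega
      subst hmm
      rw [hsm, sqNest_reg_mid]
      omega
    · have hmm : m = d + 1 := by omega
      subst hmm
      have hr0 : r = 0 := by nlinarith
      subst hr0
      rw [hsm]
      unfold sqNest
      nlinarith

end C047

end TriangleCap

end PercRepro
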